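import Summits.HodgeConjecture.CorCM.HypD1pp.A4LiuD1ppHeadOfFacts
import Literature.RepresentationTheory.MoeglinVignerasWaldspurger1987.RankOneThetaLiftIrreducibleProofs
import Literature.NumberTheory.Automorphic.Zelevinsky1980.UnitaryCharacterInductionIrreducible
import HarnessLib

/-!
# `hD1''` line `a4-liuD1pp` — the HEAD over the LAST open interface fact IV-3(a) (the split-place model), IN THE TREE
# (cell `hodgecm-mathlib`, binder `HypD1pp` = stmt-HodgeConjecture-24838)

Summits side, binder subdirectory `CorCM/HypD1pp/`.  Sequel of `A4LiuD1ppHeadOfFacts.lean` (`hypD1pp_of_facts : IV-1a → IV-3(a) →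
IV-3(b) → PrintedCitationHypotheses.HypD1pp`, p599646): two of its three hypotheses are now THEOREMS of the tree —
IV-1a `mvw_IV4_rankOne_irreducibleOrZero_holds` ([MoeglinVignerasWaldspurger1987, Chap. 3 IV.4 Thm principal 1a)]; B-p02,
`RankOneThetaLiftIrreducibleProofs.lean`, p601137) and IV-3(b) `Zelevinsky1980.parabolicIndGL_detChar_unitary_isIrreducible_holds`
([Zelevinsky1980, Thm 4.2]; B-p09, `Zelevinsky1980/UnitaryCharacterInductionIrreducible.lean`, p601139) — so the binder `hD1''`
([Liu2021, Lem. D.1, first sentence + (1)] AS PRINTED at the face datum, per admissible index and finite place) is reduced BY NAME to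
the ONE remaining interface fact IV-3(a) `Liu2021.splitPlace_chiCoinv_iso_parabolicIndGL` (the split-place model of the rank-one
theta lift, [Liu2021, proof of Lem. D.1, l. 5253; GelbartRogawski1990 §2.6]; KEY `b4-split-place-model`, B-p08):
`hypD1pp_of_splitPlaceModel : splitPlace_chiCoinv_iso_parabolicIndGL → PrintedCitationHypotheses.HypD1pp`.
Closing day for item 24838: `HD1pp_proof := hypD1pp_of_splitPlaceModel splitPlace_chiCoinv_iso_parabolicIndGL_holds`
(the route decl `Summit.HodgeConjecture.HodgeConjecture.Theses.HCCMUnconditional.HD1pp` delta-unfolds to the pack decl).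

CONDITIONAL on the named fact IV-3(a) only (D-0014).  HC_CM is proved only modulo the 7 printed citations (`hDel`, `h21`,
`hLiu418`, `h411`, `h413`, `hD3`, `hD1''`) until rung 0 closes; this file discharges no binder and no interface fact.

## References
* [Liu2021] Y. Liu, Camb. J. Math. 9 (2021) = arXiv:2102.11518, App. D Lemma D.1 (1) (l. 5246–5253).
* [MoeglinVignerasWaldspurger1987] LNM 1291, Chap. 3 IV.2, IV.4.  [Zelevinsky1980] Thm 4.2.  [GelbartRogawski1990] §2.6.
-/

set_option autoImplicit false

noncomputable section

namespace Summit.HodgeConjecture.CorCM.HypD1pp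

open Literature.NumberTheory.Automorphic.Liu2021 (splitPlace_chiCoinv_iso_parabolicIndGL)
open Literature.RepresentationTheory.MoeglinVignerasWaldspurger1987 (mvw_IV4_rankOne_irreducibleOrZero_holds)
open Literature.NumberTheory.Automorphic.Zelevinsky1980 (parabolicIndGL_detChar_unitary_isIrreducible_holds)
open Summit.HodgeConjecture.CorCM.D2Bridge.MuKeyIdentLemD3DelRecConjOmegaEndT.PrintedCitationHypotheses (HypD1pp)

/-- **`hD1''` = `PrintedCitationHypotheses.HypD1pp` FROM THE SPLIT-PLACE MODEL ALONE** — [Liu2021, Lem. D.1, first sentence + (1)]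
AS PRINTED at the face datum, per admissible index and finite place, GIVEN only IV-3(a)
`splitPlace_chiCoinv_iso_parabolicIndGL` (at a split place the `χ`-coinvariants of the rank-one Weil representation read on
`GL_n(E_w)` are the unitary parabolic induction from `P_{n−1,1}` [Liu2021 l. 5253; GelbartRogawski1990 §2.6]): `hypD1pp_of_facts`
fed with the PROVED facts IV-1a `mvw_IV4_rankOne_irreducibleOrZero_holds` and IV-3(b)
`parabolicIndGL_detChar_unitary_isIrreducible_holds` (universe `0`).
[cite: Liu2021, App. D Lem. D.1 (1) (l. 5246–5253)] [cite: MoeglinVignerasWaldspurger1987, Chap. 3 IV.4 Thm principal 1a)]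
[cite: Zelevinsky1980, Thm. 4.2] -/
theorem hypD1pp_of_splitPlaceModel (hIV3a : splitPlace_chiCoinv_iso_parabolicIndGL) : HypD1pp :=
  hypD1pp_of_facts mvw_IV4_rankOne_irreducibleOrZero_holds hIV3a parabolicIndGL_detChar_unitary_isIrreducible_holds.{0}

end Summit.HodgeConjecture.CorCM.HypD1pp

end
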